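import Summits.Ventures.Crystal3D.Theorems.StickyWulffConstantCoaxialWallLawHexCap
import HarnessLib

/-!
# FACE CAPS: occupied faces and blocked lenses host no (resp. at most one) loose witness — the TRI3 / SQ4 / DIVAC / T10 entries
# (crux `CoaxialWallLaw`, stmt-Ventures-19481; cf-p1 DECISION (cl)(1): per-pattern lemmas for cf-p2's capacity table, citable by name)

HONEST FRAMING. Venture `Summits/Ventures/Crystal3D` (cell `crystal3d-full`); helper `--supports` the crux `CoaxialWallLaw`
(stmt-Ventures-19481, `route-Ventures-StickyWulffConstant`), registered line 'CoaxialWallLawCertificates' (planner cf-p1).  Census-free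
geometry; F-C1 not moved.  Hypotheses as printed by cf-p2 (INBOX 07:50:59Z «HEX cousins»): slots are unit vectors of the host's dozen, pairwise
inner products `½` (adjacent), `0` (square diagonal); a WITNESS direction `u` (unit) keeps `⟪u, s⟫ ≤ ½` from every occupied slot `s`.
* **`no_witness_in_triangle`** (TRI3) — `a, b, c` occupied, pairwise `60°`: no unit `u = λa + μb + νc` with `λ, μ, ν ≥ 0` keeps `≤ ½` from all
  three (every point of the closed spherical triangle is within `60°` of a vertex — strictly);
* **`no_witness_in_square`** (SQ4) — `a, b, c, d` an occupied square face (`⟪a,b⟫ = ⟪b,c⟫ = ⟪c,d⟫ = ⟪d,a⟫ = ½`, `⟪a,c⟫ = ⟪b,d⟫ = 0`): no unit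
  nonnegative combination keeps `≤ ½` from all four.  (Both by `Σ λᵢ(½ − ⟪u, vᵢ⟫) ≥ 0` against `Σ λᵢ⟪u, vᵢ⟫ = ‖u‖² = 1`.)
* **`inner_gt_half_of_lens_apex_blocked`** (DIVAC) — adjacent vacant pair `(a, b)` whose triangular apex slot `c` is OCCUPIED: two unit
  directions in the open lens of `(a, b)` that both keep `≤ ½` from `c` are within `60°` of each other (they lie on the far side of the host
  plane: basis `(a, b, c)` and the far apex `T' = ⅔(a + b) − c`, `…LensCapacity`), so such a lens holds at most ONE `1`-separated witness;
* `exists_triangle_apex` — every adjacent slot pair of `fccSlots` has its triangular apex slot; **`foreign_le_one_of_ten`** (T10) — a host with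
  ten of its twelve `G`-slots occupied (two vacant, whatever they are) has at most one off-frame contact in a `1`-separated configuration
  (divacancy law `foreign_contact_adjacent_divacancy` + DIVAC; the vacant pair must be adjacent and its apex is one of the ten).
WHAT THIS IS NOT: not T9/T8 (three or four vacancies), not a certificate; F-C1 not moved.
-/

noncomputable section

namespace Summit.Ventures.Crystal3D.Theorems

namespace HexCap

open Summit.Ventures.Crystal3D Module LensCapacity NearIdentity
open scoped InnerProductSpace

/-! ### Occupied faces -/

/-- **TRI3.**  An occupied triangular face hosts no witness direction: for `u = λa + μb + νc` (`λ, μ, ν ≥ 0`, unit) one of `⟪u, a⟫, ⟪u, b⟫, ⟪u, c⟫`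
exceeds `½`. -/
theorem no_witness_in_triangle {a b c : EuclideanSpace ℝ (Fin 3)} (ha : ‖a‖ = 1) (hb : ‖b‖ = 1) (hc : ‖c‖ = 1) (hab : ⟪a, b⟫_ℝ = 1 / 2)
    (hac : ⟪a, c⟫_ℝ = 1 / 2) (hbc : ⟪b, c⟫_ℝ = 1 / 2) {l m n : ℝ} (hl : 0 ≤ l) (hm : 0 ≤ m) (hn : 0 ≤ n)
    (hu : ‖l • a + m • b + n • c‖ = 1) (hua : ⟪l • a + m • b + n • c, a⟫_ℝ ≤ 1 / 2) (hub : ⟪l • a + m • b + n • c, b⟫_ℝ ≤ 1 / 2)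
    (huc : ⟪l • a + m • b + n • c, c⟫_ℝ ≤ 1 / 2) : False := by
  obtain ⟨h1, h2, h3, hQ⟩ := inner_combo ha hb hc hab hac hbc l m n
  rw [h1] at hua; rw [h2] at hub; rw [h3] at huc; rw [hu] at hQ
  nlinarith [mul_nonneg hl hm, mul_nonneg hl hn, mul_nonneg hm hn]

/-- **SQ4.**  An occupied square face (`a, b, c, d` consecutive: adjacent pairs at `60°`, diagonals orthogonal) hosts no witness direction. -/
theorem no_witness_in_square {a b c d : EuclideanSpace ℝ (Fin 3)} (ha : ‖a‖ = 1) (hb : ‖b‖ = 1) (hc : ‖c‖ = 1) (hd : ‖d‖ = 1)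
    (hab : ⟪a, b⟫_ℝ = 1 / 2) (hbc : ⟪b, c⟫_ℝ = 1 / 2) (hcd : ⟪c, d⟫_ℝ = 1 / 2) (hda : ⟪d, a⟫_ℝ = 1 / 2) (hac : ⟪a, c⟫_ℝ = 0)
    (hbd : ⟪b, d⟫_ℝ = 0) {l m n p : ℝ} (hl : 0 ≤ l) (hm : 0 ≤ m) (hn : 0 ≤ n) (hp : 0 ≤ p)
    (hu : ‖l • a + m • b + n • c + p • d‖ = 1) (hua : ⟪l • a + m • b + n • c + p • d, a⟫_ℝ ≤ 1 / 2)
    (hub : ⟪l • a + m • b + n • c + p • d, b⟫_ℝ ≤ 1 / 2) (huc : ⟪l • a + m • b + n • c + p • d, c⟫_ℝ ≤ 1 / 2)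
    (hud : ⟪l • a + m • b + n • c + p • d, d⟫_ℝ ≤ 1 / 2) : False := by
  have haa : ⟪a, a⟫_ℝ = 1 := by rw [real_inner_self_eq_norm_sq, ha]; norm_num
  have hbb : ⟪b, b⟫_ℝ = 1 := by rw [real_inner_self_eq_norm_sq, hb]; norm_num
  have hcc : ⟪c, c⟫_ℝ = 1 := by rw [real_inner_self_eq_norm_sq, hc]; norm_num
  have hdd : ⟪d, d⟫_ℝ = 1 := by rw [real_inner_self_eq_norm_sq, hd]; norm_num
  have hba : ⟪b, a⟫_ℝ = 1 / 2 := by rw [real_inner_comm]; exact hab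
  have hcb : ⟪c, b⟫_ℝ = 1 / 2 := by rw [real_inner_comm]; exact hbc
  have hdc : ⟪d, c⟫_ℝ = 1 / 2 := by rw [real_inner_comm]; exact hcd
  have had : ⟪a, d⟫_ℝ = 1 / 2 := by rw [real_inner_comm]; exact hda
  have hca : ⟪c, a⟫_ℝ = 0 := by rw [real_inner_comm]; exact hac
  have hdb : ⟪d, b⟫_ℝ = 0 := by rw [real_inner_comm]; exact hbd
  have h1 : ⟪l • a + m • b + n • c + p • d, a⟫_ℝ = l + m / 2 + p / 2 := by
    simp only [inner_add_left, real_inner_smul_left, haa, hba, hca, hda]; ring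
  have h2 : ⟪l • a + m • b + n • c + p • d, b⟫_ℝ = l / 2 + m + n / 2 := by
    simp only [inner_add_left, real_inner_smul_left, hab, hbb, hcb, hdb]; ring
  have h3 : ⟪l • a + m • b + n • c + p • d, c⟫_ℝ = m / 2 + n + p / 2 := by
    simp only [inner_add_left, real_inner_smul_left, hac, hbc, hcc, hdc]; ring
  have h4 : ⟪l • a + m • b + n • c + p • d, d⟫_ℝ = l / 2 + n / 2 + p := by
    simp only [inner_add_left, real_inner_smul_left, had, hbd, hcd, hdd]; ring
  have hQ : ‖l • a + m • b + n • c + p • d‖ ^ 2 = l ^ 2 + m ^ 2 + n ^ 2 + p ^ 2 + l * m + m * n + n * p + p * l := by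
    rw [← real_inner_self_eq_norm_sq]
    simp only [inner_add_left, inner_add_right, real_inner_smul_left, real_inner_smul_right, haa, hbb, hcc, hdd, hab, hba, hbc, hcb, hcd,
      hdc, hda, had, hac, hca, hbd, hdb]
    ring
  rw [h1] at hua; rw [h2] at hub; rw [h3] at huc; rw [h4] at hud; rw [hu] at hQ
  nlinarith [mul_nonneg hl hm, mul_nonneg hl hn, mul_nonneg hl hp, mul_nonneg hm hn, mul_nonneg hm hp, mul_nonneg hn hp]

/-! ### Blocked lenses (DIVAC) -/

section Lens

variable {a b c : EuclideanSpace ℝ (Fin 3)} (ha : ‖a‖ = 1) (hb : ‖b‖ = 1) (hc : ‖c‖ = 1) (hab : ⟪a, b⟫_ℝ = 1 / 2)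
  (hac : ⟪a, c⟫_ℝ = 1 / 2) (hbc : ⟪b, c⟫_ℝ = 1 / 2)

include ha hb hc hab hac hbc

/-- The far apex `T' = ⅔(a + b) − c` of the lens `(a, b)` opposite to `c`: unit, at `60°` from `a` and `b`. -/
theorem far_apex_facts : ‖(2 / 3 : ℝ) • a + (2 / 3 : ℝ) • b + (-1 : ℝ) • c‖ = 1 ∧ ⟪a, (2 / 3 : ℝ) • a + (2 / 3 : ℝ) • b + (-1 : ℝ) • c⟫_ℝ = 1 / 2 ∧
    ⟪b, (2 / 3 : ℝ) • a + (2 / 3 : ℝ) • b + (-1 : ℝ) • c⟫_ℝ = 1 / 2 := by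
  obtain ⟨h1, h2, -, hQ⟩ := inner_combo ha hb hc hab hac hbc (2 / 3) (2 / 3) (-1)
  refine ⟨?_, ?_, ?_⟩
  · have : ‖(2 / 3 : ℝ) • a + (2 / 3 : ℝ) • b + (-1 : ℝ) • c‖ ^ 2 = 1 := by rw [hQ]; norm_num
    nlinarith [norm_nonneg ((2 / 3 : ℝ) • a + (2 / 3 : ℝ) • b + (-1 : ℝ) • c)]
  · rw [real_inner_comm, h1]; norm_num
  · rw [real_inner_comm, h2]; norm_num

/-- In the lens of `(a, b)`, a direction keeping `≤ ½` from the apex slot `c` has NEGATIVE `c`-coefficient. -/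
theorem coeff_neg_of_apex_blocked {l m n : ℝ} (hu : ‖l • a + m • b + n • c‖ = 1) (hua : 1 / 2 < ⟪l • a + m • b + n • c, a⟫_ℝ)
    (hub : 1 / 2 < ⟪l • a + m • b + n • c, b⟫_ℝ) (huc : ⟪l • a + m • b + n • c, c⟫_ℝ ≤ 1 / 2) : n < 0 := by
  by_contra h
  push Not at h
  have := inner_apex_gt_half ha hb hc hab hac hbc hu hua hub h
  linarith

/-- **DIVAC.**  `(a, b)` an adjacent vacant slot pair whose triangular apex slot `c` is occupied: two unit directions in the open lens of
`(a, b)` that keep `≤ ½` from `c` are within `60°` of each other — the lens holds at most ONE `1`-separated witness. -/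
theorem inner_gt_half_of_lens_apex_blocked {u u' : EuclideanSpace ℝ (Fin 3)} (hu : ‖u‖ = 1) (hua : 1 / 2 < ⟪u, a⟫_ℝ)
    (hub : 1 / 2 < ⟪u, b⟫_ℝ) (huc : ⟪u, c⟫_ℝ ≤ 1 / 2) (hu' : ‖u'‖ = 1) (hua' : 1 / 2 < ⟪u', a⟫_ℝ) (hub' : 1 / 2 < ⟪u', b⟫_ℝ)
    (huc' : ⟪u', c⟫_ℝ ≤ 1 / 2) : 1 / 2 < ⟪u, u'⟫_ℝ := by
  obtain ⟨l, m, n, rfl⟩ := exists_coeffs ha hb hc hab hac hbc u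
  obtain ⟨l', m', n', rfl⟩ := exists_coeffs ha hb hc hab hac hbc u'
  have hn := coeff_neg_of_apex_blocked ha hb hc hab hac hbc hu hua hub huc
  have hn' := coeff_neg_of_apex_blocked ha hb hc hab hac hbc hu' hua' hub' huc'
  -- rewrite both in the basis `(a, b, T')`, `T' = ⅔(a+b) − c`, where the `T'`-coefficients `−n, −n'` are positive
  obtain ⟨hT, haT, hbT⟩ := far_apex_facts ha hb hc hab hac hbc
  set T := (2 / 3 : ℝ) • a + (2 / 3 : ℝ) • b + (-1 : ℝ) • c with hTdef
  have e : ∀ l m n : ℝ, l • a + m • b + n • c = (l + 2 / 3 * n) • a + (m + 2 / 3 * n) • b + (-n) • T := by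
    intro l m n; rw [hTdef]; module
  rw [e l m n] at hu hua hub ⊢
  rw [e l' m' n'] at hu' hua' hub' ⊢
  exact inner_gt_half_of_coeffs ha hb hT hab haT hbT hu hua hub (by linarith) hu' hua' hub' (by linarith)

end Lens

/-! ### T10: ten occupied slots admit at most one off-frame contact -/

/-- Every adjacent slot pair of the model dozen has its triangular apex slot (finite check on `slotInt`). -/
theorem exists_triangle_apex_int : ∀ k l : Fin 12, slotInt k ⬝ᵥ slotInt l = 1 → ∃ j : Fin 12, slotInt j ⬝ᵥ slotInt k = 1 ∧ slotInt j ⬝ᵥ slotInt l = 1 := by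
  decide

/-- Every adjacent slot pair `v, n ∈ fccSlots` (`⟪n, v⟫ = ½`) has its triangular apex slot `c` (`⟪c, v⟫ = ⟪c, n⟫ = ½`). -/
theorem exists_triangle_apex {v n : EuclideanSpace ℝ (Fin 3)} (hv : v ∈ fccSlots) (hn : n ∈ fccSlots) (hnv : ⟪n, v⟫_ℝ = 1 / 2) :
    ∃ c ∈ fccSlots, ⟪c, v⟫_ℝ = 1 / 2 ∧ ⟪c, n⟫_ℝ = 1 / 2 := by
  obtain ⟨k, rfl⟩ := exists_slotSite_eq hv
  obtain ⟨l, rfl⟩ := exists_slotSite_eq hn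
  have h1 : slotInt l ⬝ᵥ slotInt k = 1 := by
    have := inner_slotSite l k; rw [hnv] at this
    have h2 : ((slotInt l ⬝ᵥ slotInt k : ℤ) : ℝ) = 1 := by linarith
    exact_mod_cast h2
  have h1' : slotInt k ⬝ᵥ slotInt l = 1 := by rw [dotProduct_comm]; exact h1
  obtain ⟨j, hjk, hjl⟩ := exists_triangle_apex_int k l h1'
  refine ⟨slotSite j, slotSite_mem j, ?_, ?_⟩
  · rw [inner_slotSite, hjk]; norm_num
  · rw [inner_slotSite, hjl]; norm_num

/-- **T10.**  In a `1`-separated configuration, a host `y` all of whose `G`-slots except two (`v₀, n₀`) are occupied has at most ONE off-frame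
contact: two distinct off-frame contacts `x ≠ x'` are impossible.  (By the divacancy law each blocks an adjacent vacant pair, necessarily
`{v₀, n₀}`, whose triangular apex is occupied; then DIVAC puts them within `60°`, contradicting `dist x x' ≥ 1`.) -/
theorem foreign_le_one_of_ten {X : Finset (EuclideanSpace ℝ (Fin 3))} (hX : ∀ p ∈ X, ∀ q ∈ X, p ≠ q → 1 ≤ dist p q)
    (G : EuclideanSpace ℝ (Fin 3) ≃ₗᵢ[ℝ] EuclideanSpace ℝ (Fin 3)) {y : EuclideanSpace ℝ (Fin 3)} {v₀ n₀ : EuclideanSpace ℝ (Fin 3)}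
    (hocc : ∀ w ∈ fccSlots, w ≠ v₀ → w ≠ n₀ → y + G w ∈ X)
    {x x' : EuclideanSpace ℝ (Fin 3)} (hx : x ∈ X) (hx' : x' ∈ X) (hne : x ≠ x') (hdx : dist x y = 1) (hdx' : dist x' y = 1)
    (hoff : ∀ w ∈ fccSlots, x ≠ y + G w) (hoff' : ∀ w ∈ fccSlots, x' ≠ y + G w) : False := by
  -- the blocked adjacent vacant pair of `x` is `{v₀, n₀}` (up to order), and likewise for `x'`
  obtain ⟨v, hv, n, hn, hnv, hvX, hnX, hxv, hxn⟩ := foreign_contact_adjacent_divacancy hX G hx hdx hoff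
  obtain ⟨v', hv', n', hn', hnv', hvX', hnX', hxv', hxn'⟩ := foreign_contact_adjacent_divacancy hX G hx' hdx' hoff'
  have vac : ∀ w ∈ fccSlots, y + G w ∉ X → w = v₀ ∨ w = n₀ := by
    intro w hw hwX
    by_contra h; push Not at h
    exact hwX (hocc w hw h.1 h.2)
  have slot_ne : ∀ {p q : EuclideanSpace ℝ (Fin 3)}, q ∈ fccSlots → ⟪p, q⟫_ℝ = 1 / 2 → p ≠ q := by
    intro p q hq hpq h
    rw [h, real_inner_self_eq_norm_sq, norm_eq_one_of_mem_fccSlots hq] at hpq; norm_num at hpq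
  have hvn : v ≠ n := fun h => slot_ne hv hnv h.symm
  have hv'n' : v' ≠ n' := fun h => slot_ne hv' hnv' h.symm
  -- every vacant slot is `v` or `n` (two vacancies in all)
  have two : ∀ w ∈ fccSlots, y + G w ∉ X → w = v ∨ w = n := by
    intro w hw hwX
    rcases vac w hw hwX with hw0 | hw0 <;> rcases vac v hv hvX with hv0 | hv0 <;> rcases vac n hn hnX with hn0 | hn0
    all_goals first
      | exact Or.inl (hw0.trans hv0.symm)
      | exact Or.inr (hw0.trans hn0.symm)
      | exact absurd (hv0.trans hn0.symm) hvn
  -- hence `x'` blocks the same pair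
  have key : (1 / 2 < ⟪x' - y, G v⟫_ℝ) ∧ (1 / 2 < ⟪x' - y, G n⟫_ℝ) := by
    rcases two v' hv' hvX' with h1 | h1 <;> rcases two n' hn' hnX' with h2 | h2
    · exact absurd (h1.trans h2.symm) hv'n'
    · exact ⟨by rw [← h1]; exact hxv', by rw [← h2]; exact hxn'⟩
    · exact ⟨by rw [← h2]; exact hxn', by rw [← h1]; exact hxv'⟩
    · exact absurd (h1.trans h2.symm) hv'n'
  obtain ⟨hxv'', hxn''⟩ := key
  -- the apex slot `c` of the pair `(v, n)` is occupied, and neither contact overlaps it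
  obtain ⟨c, hc, hcv, hcn⟩ := exists_triangle_apex hv hn hnv
  have hcv₀ : c ≠ v := slot_ne hv hcv
  have hcn₀ : c ≠ n := slot_ne hn hcn
  have hcX : y + G c ∈ X := by
    by_contra h
    rcases two c hc h with h1 | h1
    · exact hcv₀ h1
    · exact hcn₀ h1
  have hGv : ‖G v‖ = 1 := by rw [LinearIsometryEquiv.norm_map, norm_eq_one_of_mem_fccSlots hv]
  have hGn : ‖G n‖ = 1 := by rw [LinearIsometryEquiv.norm_map, norm_eq_one_of_mem_fccSlots hn]
  have hGc : ‖G c‖ = 1 := by rw [LinearIsometryEquiv.norm_map, norm_eq_one_of_mem_fccSlots hc]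
  have hvn' : ⟪G v, G n⟫_ℝ = 1 / 2 := by rw [LinearIsometryEquiv.inner_map_map, real_inner_comm, hnv]
  have hvc' : ⟪G v, G c⟫_ℝ = 1 / 2 := by rw [LinearIsometryEquiv.inner_map_map, real_inner_comm, hcv]
  have hnc' : ⟪G n, G c⟫_ℝ = 1 / 2 := by rw [LinearIsometryEquiv.inner_map_map, real_inner_comm, hcn]
  have hu : ‖x - y‖ = 1 := by rwa [← dist_eq_norm]
  have hu' : ‖x' - y‖ = 1 := by rwa [← dist_eq_norm]
  -- non-overlap with the ball at `y + G c`
  have sep : ∀ {z : EuclideanSpace ℝ (Fin 3)}, z ∈ X → dist z y = 1 → (∀ w ∈ fccSlots, z ≠ y + G w) → ⟪z - y, G c⟫_ℝ ≤ 1 / 2 := by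
    intro z hz hdz hoffz
    have hzn : ‖z - y‖ = 1 := by rwa [← dist_eq_norm]
    have h1 := hX z hz (y + G c) hcX (hoffz c hc)
    rw [dist_eq_norm, show z - (y + G c) = (z - y) - G c by abel] at h1
    exact inner_le_half_of_norm_sub_ge_one hzn hGc h1
  have h := inner_gt_half_of_lens_apex_blocked hGv hGn hGc hvn' hvc' hnc' hu hxv hxn (sep hx hdx hoff) hu' hxv'' hxn'' (sep hx' hdx' hoff')
  have hd : dist x x' ^ 2 < 1 := by
    rw [dist_eq_norm, show x - x' = (x - y) - (x' - y) by abel, norm_sub_sq_real, hu, hu']; linarith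
  have h1 := hX x hx x' hx' hne
  nlinarith [dist_nonneg (x := x) (y := x')]

end HexCap

end Summit.Ventures.Crystal3D.Theorems

end
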